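import Summits.PneNP.PneNP.Theses.ExpanderLinearGenerators
import Summits.PneNP.PneNP.Theorems.ExpanderLinearGeneratorsExpansionForcesDepthFregeSizeTseitin

/-!
# PneNP / ExpanderLinearGenerators — Krajíček's Problem 19.4.5 form at column weight two, from the
Galesi–Itsykson–Riazanov–Sofronova treewidth bound (stmt-PneNP-11443, conditional slice)

Route `PneNP/ExpanderLinearGenerators`, crux stmt-PneNP-11443
(`Summit.PneNP.PneNP.Theses.ExpanderLinearGenerators.LinearGeneratorDepthFregeHard`: the
expansion-scale law at scale `r := n^(1-δ)`, i.e. Krajíček's Problem 19.4.5 in universal-expander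
form). The sibling file `…ExpansionForcesDepthFregeSizeTseitin` proves the conclusion of the rank-2
crux `ExpansionForcesDepthFregeSize` on CONNECTED GRAPH-TSEITIN systems (every variable in exactly
two rows or none, connected row graph) from the named fact
`Literature.Computability.MetaComplexity.galesiEtAl_tseitin_treewidth_depthFrege_lowerBound`
(GIRS, MFCS 2019 Thm 1 / Thm 17). This file instantiates it at `r := n^(1-δ)` — the bookkeeping of
the proved glue `ExpansionGivesLinearGeneratorHard` (stmt-PneNP-11446), verbatim — giving the same
slice of crux 3:

* `linearGeneratorDepthFregeHard_tseitin_of_galesiEtAl` — for `ℓ ≥ 1`, `0 < δ < 1`, depth `d`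
  there are `ε > 0`, `N` with: every `ℓ`-sparse connected graph-Tseitin system `E` over `𝔽₂` in
  `n ≥ N` variables whose row supports form an `(n^(1-δ), 3/4 · ℓ)`-boundary expander forces every
  depth-`d` `textbookFrege` proof of `¬(sumEncoding 1 E)` to have size `≥ 2^(n^ε)` — conditional
  on the GIRS bound.

References: Galesi–Itsykson–Riazanov–Sofronova, MFCS 2019 / APAL 2023 [GalesiEtAl2023];
J. Krajíček, *Proof complexity* (CUP 2019), Problem 19.4.5, Cor. 13.4.6 [KrajicekProofComplexity2019].
-/

namespace Summit.PneNP.PneNP.Theorems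

set_option linter.dupNamespace false -- `Summit.PneNP.PneNP.…`: summit = sub-problem (D-0017)

open Filter Finset Literature.Computability.MetaComplexity Literature.Computability.Complexity

/-- **Problem 19.4.5 at column weight two, conditional on GIRS.** Assume
`galesiEtAl_tseitin_treewidth_depthFrege_lowerBound`. For every `ℓ ≥ 1`, `0 < δ < 1` and depth `d`
there are `ε > 0` and `N` such that for `n ≥ N`, every `ℓ`-sparse system `E : Fin m → LinEqMod 2 n`
whose row supports form an `(n^(1-δ), 3/4 · ℓ)`-boundary expander, which is unsolvable, in which
every variable occurs in exactly two rows or none and whose row graph is connected, admits no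
depth-`d` `textbookFrege` proof of `¬(sumEncoding 1 E)` of size `< 2^(n^ε)`. (From
`expansionForcesDepthFregeSize_tseitin_of_galesiEtAl` with `r := n^(1-δ)`, `ε' := (1-δ)ε`,
`Real.rpow_mul`.) [cite: GalesiEtAl2023, Theorem 1] -/
theorem linearGeneratorDepthFregeHard_tseitin_of_galesiEtAl
    (hGIRS : galesiEtAl_tseitin_treewidth_depthFrege_lowerBound) :
    ∀ (ℓ d : ℕ) (δ : ℝ), 1 ≤ ℓ → 0 < δ → δ < 1 → ∃ ε : ℝ, 0 < ε ∧ ∃ N : ℕ, ∀ n : ℕ, N ≤ n →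
      ∀ (m : ℕ) (E : Fin m → LinEqMod 2 n), (∀ i, (E i).supp.card ≤ ℓ) →
      IsBoundaryExpander (fun i => (E i).supp.map Fin.valEmbedding) ((n : ℝ) ^ (1 - δ)) (3 / 4 * ℓ) →
      ¬ SystemSat E Finset.univ →
      (∀ j : Fin n, (univ.filter fun i => j ∈ (E i).supp).card = 2 ∨
        (univ.filter fun i => j ∈ (E i).supp).card = 0) →
      ∀ G : SimpleGraph (Fin m),
        (∀ i i' : Fin m, G.Adj i i' ↔ i ≠ i' ∧ ((E i).supp ∩ (E i').supp).Nonempty) →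
        G.Connected →
      ∀ π : List (PropForm ℕ),
        textbookFrege.IsDepthProofOf d π (PropForm.neg (PropForm.ofCNF (sumEncoding 1 E))) →
          (2 : ℝ) ^ ((n : ℝ) ^ ε) ≤ (proofSize π : ℝ) := by
  intro ℓ d δ hℓ hδ0 hδ1
  obtain ⟨ε, hε, R, hR⟩ := expansionForcesDepthFregeSize_tseitin_of_galesiEtAl hGIRS ℓ d hℓ
  have h1δ : 0 < 1 - δ := sub_pos.mpr hδ1
  -- the expansion scale `n ^ (1 - δ)` eventually exceeds the threshold `R`
  have hT : Tendsto (fun n : ℕ => ((n : ℝ)) ^ (1 - δ)) atTop atTop :=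
    (tendsto_rpow_atTop h1δ).comp tendsto_natCast_atTop_atTop
  obtain ⟨N, hN⟩ := eventually_atTop.1 (hT.eventually_ge_atTop R)
  refine ⟨(1 - δ) * ε, mul_pos h1δ hε, N, ?_⟩
  intro n hn m E hsparse hexp hunsat htwo G hG hconn π hπ
  have hmain := hR ((n : ℝ) ^ (1 - δ)) (hN n hn) n m E hsparse hexp hunsat htwo G hG hconn π hπ
  -- `(n ^ (1 - δ)) ^ ε = n ^ ((1 - δ) * ε)`
  rwa [← Real.rpow_mul (Nat.cast_nonneg n)] at hmain

end Summit.PneNP.PneNP.Theorems
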